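import Summits.CriticalPhenomena.Ising3DConformalLimit.Theorems.AnomalousForcesInteractionEtaPositiveOfOneArm
import Literature.Probability.LatticeModels.CriticalScalingDimension
import HarnessLib

/-!
# `EtaGainIO` from a one-arm gain along ONE sequence of scales

Support file for crux `EtaPositive` (stmt-CriticalPhenomena-2600) of route `AnomalousForcesInteraction`
(sub-problem `Ising3DConformalLimit`). Write `G(x) = ⟨σ₀σ_x⟩⁺_{β_c(3),0}` (`criticalTwoPoint 3`, sup norm on
`ℤ³`) and `a_L = ⟨σ₀⟩⁺_{B(L);β_c(3),0}` (`isingCorr (zdGraph 3) (box 3 L) (criticalBeta 3) 0 .plus {0}`, the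
plus-boundary magnetisation at the centre of the box = the wired FK-Ising one-arm probability of `Λ_{L+1}`).

The landed certificate `EtaPositive_of_oneArmGain` (p152034) closes the crux from a one-arm gain
`a_L ≤ C L^{-a}`, `a > 1/2`, at ALL large scales (open in print already for any `a > 0`,
arXiv:2510.23423 after Thm 1.12). For the SIGN half of the crux isolated by the strategist's split,

  `EtaGainIO := ∃ κ > 0, C, ∀ N, ∃ x, N < ‖x‖ ∧ G(x) ≤ C ‖x‖^{-(1+κ)}`   (`⟺ ¬ HasIsingExponentEta 3 0`),

the gain is only needed along ONE sequence of scales: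

* `etaGainIO_of_oneArmGain_io` — if `a_L ≤ C L^{-a}` with `a > 1/2` for arbitrarily large `L`, then
  `EtaGainIO` holds with `κ = 2a - 1`: at `x = (2L+2) e₁` the GKS decoupling bound
  `twoPointPlus_le_isingCorr_plus_box_sq` gives `G(x) ≤ a_L² ≤ C² L^{-2a} ≤ C² 4^{2a} ‖x‖^{-2a}`.

Standard axioms, no named fact; the hypothesis is open (window `a ∈ (1/2, 3/4]` for the all-scales form,
`…EtaPositiveOneArmWindow`, p165786).
-/

namespace Summit.CriticalPhenomena.Ising3DConformalLimit.AnomalousForcesInteractionEtaPositive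

open Literature.Probability.LatticeModels Finset

/-- **`EtaGainIO` from a one-arm gain along ONE sequence of scales** (subsequence form of the certificate
`EtaPositive_of_oneArmGain`): if `⟨σ₀⟩⁺_{B(L);β_c(3),0} ≤ C L^{-a}` with `a > 1/2` holds for arbitrarily large
`L`, then a power gain `κ = 2a - 1 > 0` over the infrared bound occurs at sites of arbitrarily large norm
(GKS decoupling `⟨σ₀σ_x⟩ ≤ (⟨σ₀⟩⁺_{B(L)})²` at `x = (2L+2) e₁`). -/
theorem etaGainIO_of_oneArmGain_io : (∃ a C : ℝ, 1 / 2 < a ∧ ∀ N : ℕ, ∃ L : ℕ, N < L ∧ Literature.Probability.LatticeModels.isingCorr (Literature.Probability.LatticeModels.zdGraph 3) (Literature.Probability.LatticeModels.box 3 L) (Literature.Probability.LatticeModels.criticalBeta 3) 0 .plus {0} ≤ C * (L : ℝ) ^ (-a)) → ∃ κ C : ℝ, 0 < κ ∧ ∀ N : ℕ, ∃ x : Literature.Probability.LatticeModels.Site 3, (N : ℝ) < ‖x‖ ∧ Literature.Probability.LatticeModels.criticalTwoPoint 3 x ≤ C * (‖x‖ : ℝ) ^ (-(1 + κ)) :=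 by
  rintro ⟨a, C, ha, hio⟩
  have hβ : 0 ≤ criticalBeta 3 := criticalBeta_nonneg 3
  have ha0 : 0 < a := lt_trans (by norm_num) ha
  -- the exponent `κ = 2a - 1 > 0`, `1 + κ = 2a`
  set κ : ℝ := 2 * a - 1 with hκdef
  have hκ0 : 0 < κ := by rw [hκdef]; linarith
  have h1κ : -(1 + κ) = -(2 * a) := by rw [hκdef]; ring
  refine ⟨κ, C ^ 2 * (4 : ℝ) ^ (2 * a), hκ0, fun N => ?_⟩
  obtain ⟨L, hNL, harm⟩ := hio N
  have hL1 : 1 ≤ L := by omega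
  have hLpos : (0 : ℝ) < L := by exact_mod_cast hL1
  -- the site `x = (2L+2) e₁`
  set x : Site 3 := Pi.single 0 ((2 * L + 2 : ℕ) : ℤ) with hxdef
  have hxnorm : ‖x‖ = ((2 * L + 2 : ℕ) : ℝ) := by
    rw [hxdef, norm_single_axis, Int.cast_natCast, abs_of_nonneg (Nat.cast_nonneg _)]
  have hxn : Site.supNorm x = 2 * L + 2 := by
    have h1 := hxnorm; rw [Site.norm_eq_supNorm] at h1; exact_mod_cast h1
  have hnpos : (0 : ℝ) < ‖x‖ := by rw [hxnorm]; positivity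
  refine ⟨x, ?_, ?_⟩
  · rw [hxnorm]; exact_mod_cast (show N < 2 * L + 2 by omega)
  · -- the one-arm bound at radius `L`, squared, dominates `G(x)` (GKS decoupling)
    have hE0 : 0 ≤ isingCorr (zdGraph 3) (box 3 L) (criticalBeta 3) 0 .plus {0} :=
      GKSInequalities.gks_one_holds (zdGraph 3) hβ le_rfl (Or.inr rfl)
        (Finset.singleton_subset_iff.2 (zero_mem_box 3 L))
    have hsq : isingCorr (zdGraph 3) (box 3 L) (criticalBeta 3) 0 .plus {0} ^ 2 ≤
        (C * (L : ℝ) ^ (-a)) ^ 2 := pow_le_pow_left₀ hE0 harm 2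
    have hG : criticalTwoPoint 3 x ≤ (C * (L : ℝ) ^ (-a)) ^ 2 :=
      (twoPointPlus_le_isingCorr_plus_box_sq (d := 3) hβ (x := x) (by rw [hxn])).trans hsq
    -- exponent bookkeeping: `(C L^{-a})² = C² L^{-2a} ≤ C² 4^{2a} ‖x‖^{-2a}` since `‖x‖ = 2L+2 ≤ 4L`
    have hpow : ((L : ℝ) ^ (-a)) ^ 2 = (L : ℝ) ^ (-(2 * a)) := by
      rw [sq, ← Real.rpow_add hLpos]; ring_nf
    have hcmp : (L : ℝ) ^ (-(2 * a)) ≤ (4 : ℝ) ^ (2 * a) * (‖x‖ : ℝ) ^ (-(2 * a)) := by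
      have hL1' : (1 : ℝ) ≤ L := by exact_mod_cast hL1
      have hn4L : (‖x‖ : ℝ) ≤ 4 * (L : ℝ) := by
        rw [hxnorm]; push_cast; linarith
      have h1 : (4 * (L : ℝ)) ^ (-(2 * a)) ≤ (‖x‖ : ℝ) ^ (-(2 * a)) :=
        Real.rpow_le_rpow_of_nonpos hnpos hn4L (by linarith)
      have h2 : (4 * (L : ℝ)) ^ (-(2 * a)) = (4 : ℝ) ^ (-(2 * a)) * (L : ℝ) ^ (-(2 * a)) :=
        Real.mul_rpow (by norm_num) hLpos.le
      have h3 : (4 : ℝ) ^ (2 * a) * (4 : ℝ) ^ (-(2 * a)) = 1 := by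
        rw [Real.rpow_neg (by norm_num), mul_inv_cancel₀]
        exact (Real.rpow_pos_of_pos (by norm_num) _).ne'
      have h4 : 0 ≤ (4 : ℝ) ^ (2 * a) := Real.rpow_nonneg (by norm_num) _
      calc (L : ℝ) ^ (-(2 * a)) = (4 : ℝ) ^ (2 * a) * ((4 : ℝ) ^ (-(2 * a)) * (L : ℝ) ^ (-(2 * a))) := by
            rw [← mul_assoc, h3, one_mul]
        _ = (4 : ℝ) ^ (2 * a) * (4 * (L : ℝ)) ^ (-(2 * a)) := by rw [h2]
        _ ≤ (4 : ℝ) ^ (2 * a) * (‖x‖ : ℝ) ^ (-(2 * a)) := mul_le_mul_of_nonneg_left h1 h4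
    have hC2 : 0 ≤ C ^ 2 := sq_nonneg C
    calc criticalTwoPoint 3 x ≤ (C * (L : ℝ) ^ (-a)) ^ 2 := hG
      _ = C ^ 2 * (L : ℝ) ^ (-(2 * a)) := by rw [mul_pow, hpow]
      _ ≤ C ^ 2 * ((4 : ℝ) ^ (2 * a) * (‖x‖ : ℝ) ^ (-(2 * a))) := mul_le_mul_of_nonneg_left hcmp hC2
      _ = C ^ 2 * (4 : ℝ) ^ (2 * a) * (‖x‖ : ℝ) ^ (-(1 + κ)) := by rw [h1κ, mul_assoc]

end Summit.CriticalPhenomena.Ising3DConformalLimit.AnomalousForcesInteractionEtaPositive
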